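import Summits.Ventures.DiscreteObjects.PP12.InvolutionQuotient
import Summits.Ventures.DiscreteObjects.STD.OrderFiveReduction

/-!
# The affine part of a finite projective plane at a flag is an STD₁[n;n] (kernel)
Framing: lottery ticket; floor = certified bounds/negative ranges.

Cell pub-namedobj (venture DiscreteObjects), target (M), designs gen 9.  For a finite projective plane of order `n`
(Mathlib `Configuration.ProjectivePlane`) and a flag `c ∈ l`, the points off `l`, classed by the lines through `c`,
and the lines avoiding `c`, classed by their point on `l`, form a symmetric transversal design STD₁[n;n].  This file
builds it in the incidence-array vocabulary of the STD census (`STD.IncArray n n`, `STD.IsSTD 1`):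
* `ePts`, `eLns` — label bijections `Fin n ≃ {x ∈ X, x ≠ c}`, `Fin n ≃ {m ∋ u, m ≠ l}` (from the point/line counts);
  `lineOf i` (the `i`-th line through `c`), `ptOf i a` (its `a`-th point), `bptOf j` (the `j`-th point of `l`),
  `blkOf j b` (the `b`-th line through it);
* `affArr hcl : IncArray n n` with **`affArr_apply_eq_iff`**: `affArr i j a = b ↔ ptOf i a ∈ blkOf j b`, and
  **`isSTD_one_affArr`**: `IsSTD 1 (affArr hcl)`;
Sequel: `AffineSTDAction.lean` (coordinates `fP`, `fL` of points off `l` / lines avoiding `c`; label action of a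
`(c,l)`-collineation), `ElationQuotientSTD.lean` (elation of prime order `p` ⇒ quotient STD_p[n; n/p]).  Classical
material; formalisation ours; no `sorry`.
-/

namespace Summit.Ventures.DiscreteObjects.PP12

open Configuration Finset Summit.Ventures.DiscreteObjects.STD
open scoped Classical

section Flag

variable {P L : Type*} [Membership P L] [ProjectivePlane P L] [Fintype P] [Fintype L] {c : P} {l : L}

/-! ### Elementary incidences at a flag -/

omit [Fintype P] [Fintype L] in
/-- A point of a line `X ∋ c`, `X ≠ l`, other than `c` is off `l`. -/
theorem not_mem_of_mem_class (hcl : c ∈ l) {X : L} (hcX : c ∈ X) (hXl : X ≠ l) {x : P} (hxX : x ∈ X)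
    (hxc : x ≠ c) : x ∉ l := fun hxl => hXl ((Nondegenerate.eq_or_eq hxX hcX hxl hcl).resolve_left hxc)

omit [Fintype P] [Fintype L] in
/-- A line through a point `u ∈ l`, `u ≠ c`, other than `l` avoids `c`. -/
theorem center_not_mem_of_mem (hcl : c ∈ l) {u : P} (hul : u ∈ l) (huc : u ≠ c) {m : L} (hum : u ∈ m)
    (hml : m ≠ l) : c ∉ m := fun hcm => hml ((Nondegenerate.eq_or_eq hum hcm hul hcl).resolve_left huc)

/-! ### Counting: `n` points on a line besides one, `n` lines through a point besides one -/

omit [Fintype L] in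
/-- A line carries exactly `n` points other than a given one of its points. -/
theorem card_pts_ne [Finite L] {X : L} (hcX : c ∈ X) : Fintype.card {x : P // x ∈ X ∧ x ≠ c} = ProjectivePlane.order P L := by
  have h1 : (univ.filter fun x : P => x ∈ X).card = ProjectivePlane.order P L + 1 := by
    rw [← Fintype.card_subtype, ← Nat.card_eq_fintype_card]
    exact ProjectivePlane.pointCount_eq P X
  have h2 : (univ.filter fun x : P => x ∈ X ∧ x ≠ c) = (univ.filter fun x : P => x ∈ X).erase c := by
    ext x
    simp only [mem_filter, mem_univ, true_and, mem_erase]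
    tauto
  rw [Fintype.card_subtype, h2, card_erase_of_mem (by simpa using hcX), h1]
  rfl

omit [Fintype P] in
/-- A point carries exactly `n` lines other than a given one of its lines. -/
theorem card_lns_ne [Finite P] {u : P} (hul : u ∈ l) : Fintype.card {m : L // u ∈ m ∧ m ≠ l} = ProjectivePlane.order P L := by
  have h1 : (univ.filter fun m : L => u ∈ m).card = ProjectivePlane.order P L + 1 := by
    rw [← Fintype.card_subtype, ← Nat.card_eq_fintype_card]
    exact ProjectivePlane.lineCount_eq L u
  have h2 : (univ.filter fun m : L => u ∈ m ∧ m ≠ l) = (univ.filter fun m : L => u ∈ m).erase l := by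
    ext m
    simp only [mem_filter, mem_univ, true_and, mem_erase]
    tauto
  rw [Fintype.card_subtype, h2, card_erase_of_mem (by simpa using hul), h1]
  rfl

/-- label bijection for the points of `X` other than `c` -/
noncomputable def ePts {X : L} (hcX : c ∈ X) : Fin (ProjectivePlane.order P L) ≃ {x : P // x ∈ X ∧ x ≠ c} :=
  (Fintype.equivFinOfCardEq (card_pts_ne hcX)).symm

/-- label bijection for the lines through `u` other than `l` -/
noncomputable def eLns {u : P} (hul : u ∈ l) : Fin (ProjectivePlane.order P L) ≃ {m : L // u ∈ m ∧ m ≠ l} :=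
  (Fintype.equivFinOfCardEq (card_lns_ne hul)).symm

variable (hcl : c ∈ l)
include hcl

/-! ### Classes and labels of the flag `(c, l)` -/

/-- the `i`-th point class: a line through `c` other than `l` -/
noncomputable def lineOf (i : Fin (ProjectivePlane.order P L)) : L := (eLns (l := l) hcl i).1

/-- `c ∈ lineOf i` -/
theorem mem_lineOf (i : Fin (ProjectivePlane.order P L)) : c ∈ lineOf hcl i := (eLns hcl i).2.1

/-- `lineOf i ≠ l` -/
theorem lineOf_ne (i : Fin (ProjectivePlane.order P L)) : lineOf hcl i ≠ l := (eLns hcl i).2.2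

/-- `lineOf` is injective -/
theorem lineOf_injective : Function.Injective (lineOf (P := P) hcl) :=
  fun _ _ h => (eLns hcl).injective (Subtype.ext h)

/-- the index of a line through `c` other than `l` -/
noncomputable def idxOf (X : L) (hX : c ∈ X ∧ X ≠ l) : Fin (ProjectivePlane.order P L) := (eLns hcl).symm ⟨X, hX⟩

/-- `lineOf (idxOf X) = X` -/
@[simp] theorem lineOf_idxOf (X : L) (hX : c ∈ X ∧ X ≠ l) : lineOf hcl (idxOf hcl X hX) = X := by
  simp [lineOf, idxOf]

/-- the `a`-th point of the `i`-th class -/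
noncomputable def ptOf (i a : Fin (ProjectivePlane.order P L)) : P := (ePts (mem_lineOf hcl i) a).1

/-- `ptOf i a ∈ lineOf i` -/
theorem ptOf_mem (i a : Fin (ProjectivePlane.order P L)) : ptOf hcl i a ∈ lineOf hcl i := (ePts (mem_lineOf hcl i) a).2.1

/-- `ptOf i a ≠ c` -/
theorem ptOf_ne (i a : Fin (ProjectivePlane.order P L)) : ptOf hcl i a ≠ c := (ePts (mem_lineOf hcl i) a).2.2

/-- `ptOf i a ∉ l` -/
theorem ptOf_not_mem (i a : Fin (ProjectivePlane.order P L)) : ptOf hcl i a ∉ l :=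
  not_mem_of_mem_class hcl (mem_lineOf hcl i) (lineOf_ne hcl i) (ptOf_mem hcl i a) (ptOf_ne hcl i a)

/-- `ptOf i` is injective -/
theorem ptOf_inj_right {i a a' : Fin (ProjectivePlane.order P L)} (h : ptOf hcl i a = ptOf hcl i a') : a = a' :=
  (ePts (mem_lineOf hcl i)).injective (Subtype.ext h)

/-- a point determines its class and label -/
theorem ptOf_injective {i a i' a' : Fin (ProjectivePlane.order P L)} (h : ptOf hcl i a = ptOf hcl i' a') :
    i = i' ∧ a = a' := by
  have hi : i = i' := by
    apply lineOf_injective hcl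
    exact (Nondegenerate.eq_or_eq (ptOf_mem hcl i a) (mem_lineOf hcl i) (h ▸ ptOf_mem hcl i' a')
      (mem_lineOf hcl i')).resolve_left (ptOf_ne hcl i a)
  subst hi
  exact ⟨rfl, ptOf_inj_right hcl h⟩

/-- the label of a point of the `i`-th class -/
noncomputable def labOf (i : Fin (ProjectivePlane.order P L)) (x : P) (hx : x ∈ lineOf hcl i ∧ x ≠ c) :
    Fin (ProjectivePlane.order P L) := (ePts (mem_lineOf hcl i)).symm ⟨x, hx⟩

/-- `ptOf i (labOf i x) = x` -/
@[simp] theorem ptOf_labOf (i : Fin (ProjectivePlane.order P L)) (x : P) (hx : x ∈ lineOf hcl i ∧ x ≠ c) :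
    ptOf hcl i (labOf hcl i x hx) = x := by
  simp [ptOf, labOf]

/-- the `j`-th block class: a point of `l` other than `c` -/
noncomputable def bptOf (j : Fin (ProjectivePlane.order P L)) : P := (ePts (X := l) hcl j).1

/-- `bptOf j ∈ l` -/
theorem bptOf_mem (j : Fin (ProjectivePlane.order P L)) : bptOf hcl j ∈ l := (ePts hcl j).2.1

/-- `bptOf j ≠ c` -/
theorem bptOf_ne (j : Fin (ProjectivePlane.order P L)) : bptOf hcl j ≠ c := (ePts hcl j).2.2

/-- `bptOf` is injective -/
theorem bptOf_injective : Function.Injective (bptOf (L := L) hcl) :=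
  fun _ _ h => (ePts hcl).injective (Subtype.ext h)

/-- the index of a point of `l` other than `c` -/
noncomputable def bidxOf (u : P) (hu : u ∈ l ∧ u ≠ c) : Fin (ProjectivePlane.order P L) := (ePts hcl).symm ⟨u, hu⟩

/-- `bptOf (bidxOf u) = u` -/
@[simp] theorem bptOf_bidxOf (u : P) (hu : u ∈ l ∧ u ≠ c) : bptOf hcl (bidxOf hcl u hu) = u := by
  simp [bptOf, bidxOf]

/-- the `b`-th block of the `j`-th class: a line through `bptOf j` other than `l` -/
noncomputable def blkOf (j b : Fin (ProjectivePlane.order P L)) : L := (eLns (bptOf_mem hcl j) b).1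

/-- `bptOf j ∈ blkOf j b` -/
theorem bptOf_mem_blkOf (j b : Fin (ProjectivePlane.order P L)) : bptOf hcl j ∈ blkOf hcl j b :=
  (eLns (bptOf_mem hcl j) b).2.1

/-- `blkOf j b ≠ l` -/
theorem blkOf_ne (j b : Fin (ProjectivePlane.order P L)) : blkOf hcl j b ≠ l := (eLns (bptOf_mem hcl j) b).2.2

/-- `c ∉ blkOf j b` -/
theorem center_not_mem_blkOf (j b : Fin (ProjectivePlane.order P L)) : c ∉ blkOf hcl j b :=
  center_not_mem_of_mem hcl (bptOf_mem hcl j) (bptOf_ne hcl j) (bptOf_mem_blkOf hcl j b) (blkOf_ne hcl j b)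

/-- `blkOf j` is injective -/
theorem blkOf_inj_right {j b b' : Fin (ProjectivePlane.order P L)} (h : blkOf hcl j b = blkOf hcl j b') : b = b' :=
  (eLns (bptOf_mem hcl j)).injective (Subtype.ext h)

/-- a block determines its class and label -/
theorem blkOf_injective {j b j' b' : Fin (ProjectivePlane.order P L)} (h : blkOf hcl j b = blkOf hcl j' b') :
    j = j' ∧ b = b' := by
  have hj : j = j' := by
    apply bptOf_injective hcl
    exact (Nondegenerate.eq_or_eq (bptOf_mem_blkOf hcl j b) (h ▸ bptOf_mem_blkOf hcl j' b') (bptOf_mem hcl j)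
      (bptOf_mem hcl j')).resolve_right (blkOf_ne hcl j b)
  subst hj
  exact ⟨rfl, blkOf_inj_right hcl h⟩

/-- the label of a block of the `j`-th class -/
noncomputable def blabOf (j : Fin (ProjectivePlane.order P L)) (m : L) (hm : bptOf hcl j ∈ m ∧ m ≠ l) :
    Fin (ProjectivePlane.order P L) := (eLns (bptOf_mem hcl j)).symm ⟨m, hm⟩

/-- `blkOf j (blabOf j m) = m` -/
@[simp] theorem blkOf_blabOf (j : Fin (ProjectivePlane.order P L)) (m : L) (hm : bptOf hcl j ∈ m ∧ m ≠ l) :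
    blkOf hcl j (blabOf hcl j m hm) = m := by
  simp [blkOf, blabOf]

/-! ### The incidence array -/

/-- a point off `l` and a point of `l` are distinct -/
theorem ptOf_ne_bptOf (i a j : Fin (ProjectivePlane.order P L)) : ptOf hcl i a ≠ bptOf hcl j :=
  fun h => ptOf_not_mem hcl i a (h ▸ bptOf_mem hcl j)

/-- the label, in block class `j`, of the line joining `ptOf i a` to `bptOf j` -/
noncomputable def affLabel (i j a : Fin (ProjectivePlane.order P L)) : Fin (ProjectivePlane.order P L) :=
  blabOf hcl j (HasLines.mkLine (ptOf_ne_bptOf hcl i a j) : L)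
    ⟨(HasLines.mkLine_ax (ptOf_ne_bptOf hcl i a j)).2, fun h => ptOf_not_mem hcl i a (by
      have hm : ptOf hcl i a ∈ (HasLines.mkLine (ptOf_ne_bptOf hcl i a j) : L) :=
        (HasLines.mkLine_ax (ptOf_ne_bptOf hcl i a j)).1
      rw [h] at hm; exact hm)⟩

/-- `ptOf i a` lies on the block labelled `affLabel i j a` -/
theorem ptOf_mem_blkOf_affLabel (i j a : Fin (ProjectivePlane.order P L)) :
    ptOf hcl i a ∈ blkOf hcl j (affLabel hcl i j a) := by
  unfold affLabel
  rw [blkOf_blabOf]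
  exact (HasLines.mkLine_ax (ptOf_ne_bptOf hcl i a j)).1

/-- a block contains at most one point of each class -/
theorem eq_of_mem_blkOf {i a a' j b : Fin (ProjectivePlane.order P L)} (ha : ptOf hcl i a ∈ blkOf hcl j b)
    (ha' : ptOf hcl i a' ∈ blkOf hcl j b) : a = a' := by
  by_contra hne
  have hne' : ptOf hcl i a ≠ ptOf hcl i a' := fun h => hne (ptOf_inj_right hcl h)
  have : blkOf hcl j b = lineOf hcl i :=
    (Nondegenerate.eq_or_eq ha ha' (ptOf_mem hcl i a) (ptOf_mem hcl i a')).resolve_left hne'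
  exact center_not_mem_blkOf hcl j b (this ▸ mem_lineOf hcl i)

/-- the characterisation of `affLabel`: `affLabel i j a = b ↔ ptOf i a ∈ blkOf j b` -/
theorem affLabel_eq_iff {i j a b : Fin (ProjectivePlane.order P L)} :
    affLabel hcl i j a = b ↔ ptOf hcl i a ∈ blkOf hcl j b := by
  constructor
  · rintro rfl; exact ptOf_mem_blkOf_affLabel hcl i j a
  · intro h
    -- both blocks of class j contain bptOf j and ptOf i a
    have h1 := ptOf_mem_blkOf_affLabel hcl i j a
    exact blkOf_inj_right hcl ((Nondegenerate.eq_or_eq h1 (bptOf_mem_blkOf hcl j _) h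
      (bptOf_mem_blkOf hcl j b)).resolve_left (ptOf_ne_bptOf hcl i a j))

/-- `affLabel i j` is a bijection of the labels -/
theorem affLabel_bijective (i j : Fin (ProjectivePlane.order P L)) : Function.Bijective (affLabel hcl i j) := by
  rw [← Finite.injective_iff_bijective]
  intro a a' h
  have ha := ptOf_mem_blkOf_affLabel hcl i j a
  rw [h] at ha
  exact eq_of_mem_blkOf hcl ha (ptOf_mem_blkOf_affLabel hcl i j a')

/-- **The affine incidence array of the flag `(c, l)`.** -/
noncomputable def affArr : IncArray (ProjectivePlane.order P L) (ProjectivePlane.order P L) :=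
  fun i j => Equiv.ofBijective (affLabel hcl i j) (affLabel_bijective hcl i j)

/-- **Incidence.** `affArr i j a = b` iff the point `ptOf i a` lies on the line `blkOf j b`. -/
theorem affArr_apply_eq_iff {i j a b : Fin (ProjectivePlane.order P L)} :
    affArr hcl i j a = b ↔ ptOf hcl i a ∈ blkOf hcl j b := by
  unfold affArr
  rw [Equiv.ofBijective_apply]
  exact affLabel_eq_iff hcl

/-- the inverse form: `(affArr i j)⁻¹ b = a ↔ ptOf i a ∈ blkOf j b` -/
theorem affArr_symm_apply_eq_iff {i j a b : Fin (ProjectivePlane.order P L)} :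
    (affArr hcl i j).symm b = a ↔ ptOf hcl i a ∈ blkOf hcl j b := by
  rw [Equiv.symm_apply_eq, eq_comm]
  exact affArr_apply_eq_iff hcl

/-- **The affine part of a projective plane at a flag is an STD₁[n;n].** -/
theorem isSTD_one_affArr : IsSTD 1 (affArr hcl) := by
  constructor
  · intro i i' hii' a b
    rw [card_eq_one]
    -- the unique block class is that of the point xy ∩ l
    have hxy : ptOf hcl i a ≠ ptOf hcl i' b := fun h => hii' (ptOf_injective hcl h).1
    obtain ⟨m, hxm, hym⟩ : ∃ m : L, ptOf hcl i a ∈ m ∧ ptOf hcl i' b ∈ m :=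
      ⟨_, (HasLines.mkLine_ax hxy).1, (HasLines.mkLine_ax hxy).2⟩
    have hml : m ≠ l := fun h => ptOf_not_mem hcl i a (h ▸ hxm)
    have hcm : c ∉ m := by
      intro hcm
      have : m = lineOf hcl i :=
        (Nondegenerate.eq_or_eq hcm hxm (mem_lineOf hcl i) (ptOf_mem hcl i a)).resolve_left (ptOf_ne hcl i a).symm
      have hy : ptOf hcl i' b ∈ lineOf hcl i := this ▸ hym
      have hii : lineOf hcl i = lineOf hcl i' :=
        (Nondegenerate.eq_or_eq hy (mem_lineOf hcl i) (ptOf_mem hcl i' b) (mem_lineOf hcl i')).resolve_left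
          (ptOf_ne hcl i' b)
      exact hii' (lineOf_injective hcl hii)
    obtain ⟨z, hzm, hzl⟩ : ∃ z : P, z ∈ m ∧ z ∈ l := ⟨_, (HasPoints.mkPoint_ax hml).1, (HasPoints.mkPoint_ax hml).2⟩
    have hzc : z ≠ c := fun h => hcm (h ▸ hzm)
    refine ⟨bidxOf hcl z ⟨hzl, hzc⟩, ?_⟩
    ext j
    simp only [mem_filter, mem_univ, true_and, mem_singleton]
    -- `affArr i j a = affArr i' j b` iff `ptOf i' b` lies on the block of class `j` through `ptOf i a`
    have hxB : ∀ j, ptOf hcl i a ∈ blkOf hcl j (affArr hcl i j a) := fun j => (affArr_apply_eq_iff hcl).1 rfl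
    constructor
    · intro hyB'
      have hyB : ptOf hcl i' b ∈ blkOf hcl j (affArr hcl i j a) := (affArr_apply_eq_iff hcl).1 hyB'.symm
      -- that block is `m`, so `bptOf j = z`
      have hBm : blkOf hcl j (affArr hcl i j a) = m := (Nondegenerate.eq_or_eq (hxB j) hyB hxm hym).resolve_left hxy
      have huz : bptOf hcl j = z := by
        have hu := bptOf_mem_blkOf hcl j (affArr hcl i j a)
        rw [hBm] at hu
        exact (Nondegenerate.eq_or_eq hu hzm (bptOf_mem hcl j) hzl).resolve_right hml
      apply bptOf_injective hcl
      rw [huz, bptOf_bidxOf]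
    · intro hj
      subst hj
      -- the block of class `z` through `ptOf i a` is `m`
      have hu : bptOf hcl (bidxOf hcl z ⟨hzl, hzc⟩) = z := bptOf_bidxOf hcl z _
      have hBm : blkOf hcl (bidxOf hcl z ⟨hzl, hzc⟩) (affArr hcl i (bidxOf hcl z ⟨hzl, hzc⟩) a) = m := by
        have h1 := bptOf_mem_blkOf hcl (bidxOf hcl z ⟨hzl, hzc⟩) (affArr hcl i (bidxOf hcl z ⟨hzl, hzc⟩) a)
        rw [hu] at h1
        exact (Nondegenerate.eq_or_eq (hxB _) h1 hxm hzm).resolve_left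
          (fun h => ptOf_not_mem hcl i a (h ▸ hzl))
      symm
      exact (affArr_apply_eq_iff hcl).2 (hBm ▸ hym)
  · intro j j' hjj' b d
    rw [card_eq_one]
    -- the unique point class is that of the point m ∩ m'
    have hmm : blkOf hcl j b ≠ blkOf hcl j' d := fun h => hjj' (blkOf_injective hcl h).1
    obtain ⟨z, hzm, hzm'⟩ : ∃ z : P, z ∈ blkOf hcl j b ∧ z ∈ blkOf hcl j' d :=
      ⟨_, (HasPoints.mkPoint_ax hmm).1, (HasPoints.mkPoint_ax hmm).2⟩
    have hzc : z ≠ c := fun h => center_not_mem_blkOf hcl j b (h ▸ hzm)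
    have hzl : z ∉ l := by
      intro hzl
      have h1 : z = bptOf hcl j :=
        (Nondegenerate.eq_or_eq hzm (bptOf_mem_blkOf hcl j b) hzl (bptOf_mem hcl j)).resolve_right (blkOf_ne hcl j b)
      have h2 : z = bptOf hcl j' :=
        (Nondegenerate.eq_or_eq hzm' (bptOf_mem_blkOf hcl j' d) hzl (bptOf_mem hcl j')).resolve_right
          (blkOf_ne hcl j' d)
      exact hjj' (bptOf_injective hcl (h1.symm.trans h2))
    have hcz : c ≠ z := hzc.symm
    obtain ⟨X, hcX, hzX⟩ : ∃ X : L, c ∈ X ∧ z ∈ X := ⟨_, (HasLines.mkLine_ax hcz).1, (HasLines.mkLine_ax hcz).2⟩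
    have hXl : X ≠ l := fun h => hzl (h ▸ hzX)
    refine ⟨idxOf hcl X ⟨hcX, hXl⟩, ?_⟩
    ext i
    simp only [mem_filter, mem_univ, true_and, mem_singleton]
    constructor
    · intro h
      -- the point of class i on blkOf j b also lies on blkOf j' d, so it is z
      have h1 : ptOf hcl i ((affArr hcl i j).symm b) ∈ blkOf hcl j b := (affArr_symm_apply_eq_iff hcl).1 rfl
      have h2 : ptOf hcl i ((affArr hcl i j).symm b) ∈ blkOf hcl j' d := by
        rw [h]; exact (affArr_symm_apply_eq_iff hcl).1 rfl
      have hxz : ptOf hcl i ((affArr hcl i j).symm b) = z :=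
        (Nondegenerate.eq_or_eq h1 hzm h2 hzm').resolve_right hmm
      apply lineOf_injective hcl
      rw [lineOf_idxOf]
      exact (Nondegenerate.eq_or_eq (mem_lineOf hcl i) (hxz ▸ ptOf_mem hcl i _) hcX hzX).resolve_left hcz
    · intro hi
      subst hi
      have hzX' : z ∈ lineOf hcl (idxOf hcl X ⟨hcX, hXl⟩) ∧ z ≠ c := by
        rw [lineOf_idxOf]; exact ⟨hzX, hzc⟩
      have e1 : (affArr hcl (idxOf hcl X ⟨hcX, hXl⟩) j).symm b = labOf hcl _ z hzX' :=
        (affArr_symm_apply_eq_iff hcl).2 (by rw [ptOf_labOf]; exact hzm)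
      have e2 : (affArr hcl (idxOf hcl X ⟨hcX, hXl⟩) j').symm d = labOf hcl _ z hzX' :=
        (affArr_symm_apply_eq_iff hcl).2 (by rw [ptOf_labOf]; exact hzm')
      rw [e1, e2]

end Flag

end Summit.Ventures.DiscreteObjects.PP12
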